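import Summits.QuantumFields.YangMills.Theorems.BalabanUVNodesN12GuardedChartDerivDeviation
import Literature.MathematicalPhysics.QuantumFieldTheory.Balaban1983to89.Node00.MultiScaleFibreChartB
import HarnessLib

/-!
# BalabanUVNodes ∕ N12 — (J-iii) at the chart level: THE DEVIATION OF `DΨ_U(0)` FROM THE `linAvg`-RECURSION `Q^{(j)}` IS LINEAR IN `‖↑U − 1‖` NEAR THE FLAT CONFIGURATION — **BOND-DATUM EDITION** (`…N12GuardedChartDerivDeviationB`, USED DECLARATIONS ONLY)

The print-datum ([Balaban1984PropagatorsII] (2.3)) (γ) twin of `Summits/…/Theorems/BalabanUVNodesN12GuardedChartDerivDeviation.lean`: the declarations of the parent whose STATEMENT reads the determining datum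
(`exists_norm_fderiv_msChart_sub_suProj_iterLin_le`, `fderiv_msChart_apply_eq_of_plaqSmall`) and which N12's junction of record v14ᴸ uses (dag-n12-c g35 probe-2 census `UsedConstsN12RoadTyped2`, THEOREMS block), re-typed over a
BOND-LEVEL datum `𝔅 : BDetSet` (F0a `B15DeterminingSetsB`) and dag-n12-c's bond-datum chart `Node00.msChartB` (✓p774329; `msChart 𝐁 = msChartB (bondsDet 𝐁)` by `rfl`).  GENERATOR twin
(this seat's `work/g32/gen_thm.py`, block-extracted from the parent's tree bytes): namespace `…N12GuardedChartDerivDeviationB`, SAME short names, `DetSet ↦ BDetSet`, `AgreeOn 𝐁 ↦ AgreeOnB 𝔅`,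
`IsMinimizer ↦ IsMinimizerB`, `bondsOf (𝐁 j) ↦ 𝔅 j`, `msChart ∕ constrCard ∕ constrEnum ∕ ConstrSet ↦ …B`, NODE 00 chart lemmas `…msChart… ↦ …msChartB…`; proofs VERBATIM; the parent's
datum-free declarations REUSED BY NAME (`open`), never copied (private plumbing excepted, №366 R2).  The parent's (b) statements are the instances `𝔅 := bondsDet 𝐁`.

Cell `pub-ymgap` (HUMAN RULINGS D-0062 ∕ D-0149), seat `pub-ymgap-dag-n12-d` g32 (R134 N12 [B15] s2; the (ii) Theorems-side re-key of N12's road at print's [II] (2.3) datum — director-ym №338 ∕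
№343 (E1)(iii-b), FLAG №16 ∕ ruling (α); dag-n12-c DESIGN memo a793b2ebc0b803bf (ii); `N12-ROAD-TWIN-ORDER-2026-08-30.md`).  Count-neutral helper of K1⁹ `stmt-QuantumFields-27364`,
`--kind proof --supports … --as helper`.  THEOREMS ONLY (0 `def`, 0 `instance`, 0 `sorry`).

HONEST FRAMING (director-ym №338 (5)).  PURELY ADDITIVE: the parent stays landed and true on its own text; nothing in it is edited; no displayed premise of any consumer is deleted or
weakened; every hypothesis of the parent stays a hypothesis.  Nothing of Bałaban's analysis asserted; N12 NOT discharged; K0⁷ ∕ K1⁹ NOT closed; counts unmoved (typed 28∕28 · discharged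
8∕27, A 8∕28; K 1∕4); one finite 𝕋⁴ programme at fixed ε — R4 closes the conditional rung `BalabanLadder.UV` only; NOT the Yang–Mills mass gap (Clay); nothing continuum ∕ ℝ⁴ ∕ OS.

PARENT's DOCSTRING (the mathematics and the citations; read the site-level `𝐁` as the bond datum `𝔅`):
# BalabanUVNodes ∕ N12 — (J-iii) at the chart level: THE DEVIATION OF `DΨ_U(0)` FROM THE `linAvg`-RECURSION `Q^{(j)}` IS LINEAR IN `‖↑U − 1‖` NEAR THE FLAT CONFIGURATION
# (the `(δ₂)` letter the N12 road U2c⁺ absorbs into `Cerr`: `‖(DΦ_U(0)X)_i − π((Q^{(j)}↑X)(c))‖ ≤ C·‖↑U − 1‖·‖↑X‖`, `C, ρ` chosen BEFORE `U`)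

Cell `pub-ymgap` (D-0062 ∕ D-0149), width seat `pub-ymgap-dag-n10-w1` g0; lane word dag-n12-c g16 (bus l.≈27120: «YES to the chart-level three-term combination … EXPLICITLY LINEAR in the
smallness δ (an ∃-constant in front is fine; hidden δ-dependence is not) … `C` depending on `L, k, d` only»).  Key K1⁷ `stmt-QuantumFields-20542`, `--kind proof --supports … --as helper`;
count-neutral; THEOREMS ONLY.  STANDALONE EDITION: §0 re-proves PRIVATELY (verbatim) the letters of this seat's module C `…N12GuardedChartDerivIterLin` (p596651 ✓), whose farm olean
was not built in time to be imported — cite module C's PUBLIC originals, never §0.  CONSUMED BY NAME: n07-e's 35b-i `Node00.AveragingSmooth` (`iterM`, `coeField`, `contDiffAt_iterM`,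
`coeField_avgFamily_eq_iterM`), 35e `…N07CritTangentConverse` (`hasDerivAt_coeField_iter`, `smallBelow_of_plaqSmall`), this seat's module B (`hasDerivAt_coe_iter_expChart_one_smul`),
n07-w2's `Node00.MultiScaleFibreChart` (`msChart`, `suProj`, `fderiv_msChart_apply_of_hasDerivAt`), Mathlib (`ContDiffAt.exists_lipschitzOnWith`, `norm_star`, `SemilinearMapClass.bound_of_continuous`).
THE PRINT.  [Balaban1985Averaging] Prop. 3 (121)–(125) p. 36 (linearised average = `L(Q(V₀)A)` + terms `O(L²α₀)`); [Balaban1985Variational] Sect. C (44)–(48) p. 285, (83) p. 290;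
[Balaban1987RG1] (0.4) p. 253, (0.21) p. 256.
CONTENTS.  §1 letters (`exists_norm_fderiv_iterM_sub_fderiv_one_le`, `exists_norm_fderiv_iterM_le`, the `↑U_b − 1` twist `norm_coeMul_sub_le`, the `W* − 1` twist = `Node00.norm_star_sub_one` of `WilsonActionSecondVariationNearFlat` (imported),
`exists_norm_suProj_le`, `exists_levelLetters[_uniform]` — ONE pair `K, ρ` for all levels `j ≤ k`).  §2 ★★ `exists_norm_leftTriv_fderiv_iterM_sub_iterLin_le` — GUARD-FREE, CHART-FREE core
estimate `‖(iterM j ↑U)(c)*·(D(Ū^j)(↑U)[b ↦ ↑U_b·↑X_b])(c) − (Q^{(j)}↑X)(c)‖ ≤ C·‖↑U − 1‖·‖↑X‖` (`j ≤ k`, `‖↑U − 1‖ < ρ`; the left entry is n07-w1's `qLin j U X c` by `rfl`) by the split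
`W*·a − q = (W* − 1)·a + (a − a′) + (a′ − q)`.  §3 ★★★ `exists_norm_fderiv_msChart_sub_suProj_iterLin_le` — the `(δ₂)` LETTER at NODE 00's chart (module C §3 + §2 through a bound of `π`),
★ `…_of_forall_norm_sub_one_le` — the lane word's shape on the bondwise guard `∀ b, ‖↑U_b − 1‖ ≤ δ < ρ`: `≤ C·δ·‖↑X‖`.
HONEST FRAMING.  Constants EXIST by smoothness near the flat configuration (C¹ ⇒ Lipschitz derivative on a ball) — print's explicit `O(L²α₀)` is NOT claimed; BOTH guards displayed
(`‖↑U − 1‖ < ρ` for the deviation, 35e's plaquette guard for the chart's differentiability); `π = suProj` enters through `‖π(v)‖ ≤ c‖v‖` (the operator-norm instance into the pinned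
`𝔰𝔲(N)` structures is not synthesizable, so no `‖π‖` is written).  Nothing of Bałaban's estimates asserted; N12 NOT discharged; count-neutral (typed 28∕28 · discharged 5∕27 unmoved);
one finite 𝕋⁴ programme at fixed ε — R4 closes the conditional rung `BalabanLadder.UV` only; the YM mass gap (Clay) is NOT proved by any of this.  No `sorry`∕`def`∕`instance`∕`notation`.
-/

noncomputable section

open scoped BigOperators Matrix.Norms.L2Operator Topology NNReal
open Filter Asymptotics Finset

namespace Summit.QuantumFields.YangMills.BalabanUVNodes.N12GuardedChartDerivDeviationB

open Literature.MathematicalPhysics.QuantumFieldTheory.Balaban1983to89.B15DeterminingSetsB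

open Literature.MathematicalPhysics.QuantumFieldTheory.Balaban1983to89
open T4Continuum (T4Family)
open BlockAveraging (blockAvg)
open ExpMeanLog (expMeanLogSU deltaSU deltaSU_pos)
open BlockAveragingEMLLinearised (linAvg)
open T4AdjointCovarianceUnitary (lieSU expSU)
open B15DeterminingSets
open Node00
open Summit.QuantumFields.YangMills.Theorems.BlockAvgCorrector (stokesConst stokesConst_nonneg)
open Summit.QuantumFields.YangMills.BalabanUVNodes.N07CritTangentConverse (hasDerivAt_coeField_iter smallBelow_of_plaqSmall)
open Summit.QuantumFields.YangMills.BalabanUVNodes.N12FlatChartDerivIterLin (hasDerivAt_coe_iter_expChart_one_smul hasDerivAt_coe_expChart_one_smul)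
open Summit.QuantumFields.YangMills.BalabanUVNodes.N12GuardedChartDerivDeviation (exists_norm_leftTriv_fderiv_iterM_sub_iterLin_le exists_norm_suProj_le)

section
variable {F : T4Family} {N : ℕ} [NeZero N] {K k : ℕ}

/-- (module C §3, private copy) `(DΦ_U(0)X)_{(j,c)} = π((M˙U)_j(c)*·(D(Ū^j)(↑U)(↑U·↑X))(c))` on 35e's guard. [cite: Balaban1985Variational, (44)-(48) p.285, (83) p.290; Balaban1987RG1, (0.21) p.256] -/
private theorem fderiv_msChart_apply_eq_of_plaqSmall {t₀ : ℝ} (ht₀ : 0 < t₀) (hstδ : stokesConst (F.P K) * t₀ < deltaSU (Fin N))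
    {U : GaugeField (F.P K) 0 (SU N)} (hsm : ∀ i, i < k → PlaqSmall t₀ (Averaging.iter (avOfRecord F N K) i U))
    (𝔅 : BDetSet (F.P K)) (X : PBond (F.P K) 0 → lieSU (Fin N)) (i : Fin (constrCardB 𝔅 k)) :
    fderiv ℝ (msChartB F N K k 𝔅 (avgFamily (avOfRecord F N K) U) U) 0 X i
      = suProj N (star ((avgFamily (avOfRecord F N K) U ((constrEnumB 𝔅 k).symm i).1 ((constrEnumB 𝔅 k).symm i).2.1 : SU N) : Matrix (Fin N) (Fin N) ℂ) *
          fderiv ℝ (iterM (((constrEnumB 𝔅 k).symm i).1 : ℕ))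
            (coeField U) (fun b => (U b : Matrix (Fin N) (Fin N) ℂ) * (X b : Matrix (Fin N) (Fin N) ℂ)) ((constrEnumB 𝔅 k).symm i).2.1) := by
  set s := (constrEnumB 𝔅 k).symm i with hs
  have hj : (s.1 : ℕ) ≤ k := Nat.lt_succ_iff.1 s.1.2
  have hΓ : HasDerivAt (fun t : ℝ => coeField (expChart U (t • X))) (fun b => (U b : Matrix (Fin N) (Fin N) ℂ) * (X b : Matrix (Fin N) (Fin N) ℂ)) 0 :=
    hasDerivAt_pi.2 fun b => hasDerivAt_coe_expChart_along (hasDerivAt_ray X) (zero_smul ℝ X) b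
  have hsm' : ∀ i', i' < (s.1 : ℕ) → PlaqSmall t₀ (Averaging.iter (fun i => blockAvg (P := F.P K) (j := i) (expMeanLogSU (n := Fin N))) i' (expChart U ((0 : ℝ) • X))) :=
    fun i' hi' => by rw [zero_smul, expChart_zero]; exact hsm i' (lt_of_lt_of_le hi' hj)
  have hvel := hasDerivAt_coeField_iter (k := (s.1 : ℕ)) ht₀ hstδ hΓ hsm'
  have hvelc : HasDerivAt (fun t : ℝ => ((avgFamily (avOfRecord F N K) (expChart U (t • X)) s.1 s.2.1 : SU N) : Matrix (Fin N) (Fin N) ℂ))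
      (fderiv ℝ (iterM (s.1 : ℕ)) (coeField U) (fun b => (U b : Matrix (Fin N) (Fin N) ℂ) * (X b : Matrix (Fin N) (Fin N) ℂ)) s.2.1) 0 := by
    have h := (hasDerivAt_pi.1 hvel) s.2.1
    rw [zero_smul, expChart_zero] at h
    exact h
  have hsb : SmallBelow (avOfRecord F N K) k U := smallBelow_of_plaqSmall ht₀ hstδ hsm
  exact fderiv_msChartB_apply_of_hasDerivAt (fun _ _ _ => rfl) hsb X i hvelc

end

section
variable {F : T4Family} {N : ℕ} [NeZero N] {K k : ℕ}

/-- ★★★ **THE `(δ₂)` LETTER — THE CHART-LEVEL DEVIATION IS LINEAR IN `‖↑U − 1‖`**: `∃ C ρ` chosen BEFORE the configuration (depending on `F.P K`, `N`, `k`, `Q` only) such that for every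
`t₀ > 0` with `stokesConst·t₀ < δ_N`, every `U` on 35e's guard (`PlaqSmall t₀ (Ū^i U)`, `i < k`) with `‖↑U − 1‖ < ρ`, every level-bounded `𝔅`, direction `X` and constrained bond `i ↔ (j, c)`:
`‖(DΦ_U(0)X)_i − π((Q^{(j)}↑X)(c))‖ ≤ C·‖↑U − 1‖·‖↑X‖`, `Φ = msChartB F N K k 𝔅 (M˙U) U` (module C §3 + `↑Ū^j(U)(c) = (iterM j ↑U)(c)` under the guard + §2 through the bound of `π`).
[cite: Balaban1985Averaging, Prop. 3 (121)-(125) p.36; Balaban1985Variational, (44)-(48) p.285, (83) p.290; Balaban1987RG1, (0.21) p.256] -/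
theorem exists_norm_fderiv_msChart_sub_suProj_iterLin_le
    (Q : (i : ℕ) → (PBond (F.P K) 0 → Matrix (Fin N) (Fin N) ℂ) → PBond (F.P K) i → Matrix (Fin N) (Fin N) ℂ)
    (hQ0 : ∀ Y, Q 0 Y = Y) (hQs : ∀ (i : ℕ) (Y : PBond (F.P K) 0 → Matrix (Fin N) (Fin N) ℂ) (c : PBond (F.P K) (i + 1)), Q (i + 1) Y c = linAvg (Q i Y) c) :
    ∃ C ρ : ℝ, 0 ≤ C ∧ 0 < ρ ∧ ∀ ⦃t₀ : ℝ⦄, 0 < t₀ → stokesConst (F.P K) * t₀ < deltaSU (Fin N) →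
      ∀ U : GaugeField (F.P K) 0 (SU N), (∀ i, i < k → PlaqSmall t₀ (Averaging.iter (avOfRecord F N K) i U)) → ‖coeField U - 1‖ < ρ →
      ∀ (𝔅 : BDetSet (F.P K)) (X : PBond (F.P K) 0 → lieSU (Fin N)) (i : Fin (constrCardB 𝔅 k)),
        ‖fderiv ℝ (msChartB F N K k 𝔅 (avgFamily (avOfRecord F N K) U) U) 0 X i
            - suProj N (Q (((constrEnumB 𝔅 k).symm i).1 : ℕ) (fun b => (X b : Matrix (Fin N) (Fin N) ℂ)) ((constrEnumB 𝔅 k).symm i).2.1)‖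
          ≤ C * ‖coeField U - 1‖ * ‖(fun b => (X b : Matrix (Fin N) (Fin N) ℂ))‖ := by
  obtain ⟨C₀, ρ, hC₀, hρ, hcore⟩ := exists_norm_leftTriv_fderiv_iterM_sub_iterLin_le Q hQ0 hQs k
  obtain ⟨cπ, hcπ, hπ⟩ := exists_norm_suProj_le (N := N)
  refine ⟨cπ * C₀, ρ, by positivity, hρ, fun t₀ ht₀ hstδ U hsm hU 𝔅 X i => ?_⟩
  set s := (constrEnumB 𝔅 k).symm i with hs
  have hj : (s.1 : ℕ) ≤ k := Nat.lt_succ_iff.1 s.1.2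
  have hchart := fderiv_msChart_apply_eq_of_plaqSmall ht₀ hstδ hsm 𝔅 X i
  have hsb : SmallBelow (avOfRecord F N K) (s.1 : ℕ) U := (smallBelow_of_plaqSmall ht₀ hstδ hsm).mono hj
  have hWeq : ((avgFamily (avOfRecord F N K) U s.1 s.2.1 : SU N) : Matrix (Fin N) (Fin N) ℂ)
      = (iterM (s.1 : ℕ)) (coeField U) s.2.1 := by
    have h := congrFun (coeField_avgFamily_eq_iterM (k := (s.1 : ℕ)) hsb) s.2.1
    rw [coeField_apply] at h
    exact h
  rw [hchart, ← map_sub, hWeq]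
  calc _ ≤ cπ * _ := hπ _
    _ ≤ cπ * (C₀ * ‖coeField U - 1‖ * ‖(fun b => (X b : Matrix (Fin N) (Fin N) ℂ))‖) :=
        mul_le_mul_of_nonneg_left (hcore (s.1 : ℕ) hj U hU X s.2.1) hcπ
    _ = cπ * C₀ * ‖coeField U - 1‖ * ‖(fun b => (X b : Matrix (Fin N) (Fin N) ℂ))‖ := by ring

end

end Summit.QuantumFields.YangMills.BalabanUVNodes.N12GuardedChartDerivDeviationB

end
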